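import Literature.Combinatorics.SimpleGraph.HamiltonianPathCount
import Literature.Combinatorics.SimpleGraph.HamiltonianPathExpansion
import HarnessLib

/-!
# Gadget substitution for Hamiltonian-path counts, I: gadgets, covers, contraction of a path

The method of **local replacement** (Garey–Johnson 1979, §3.2.2) for COUNTING Hamiltonian paths,
as used by Garey–Johnson–Tarjan 1976 and Liśkiewicz–Ogihara–Toda 2003 (§3, Lemma 4: Tutte-,
XOR- and OR-gadgets, "there are four ways to do the former and two ways to do the latter", "for
each of the two vertical axes there are `(4·2)⁴ = 2¹²` Hamiltonian paths that traverse the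
gadget"). A set `S` of edges ("slots") of a base graph `M` on the vertex set `V` is deleted and a
gadget — fresh vertices `VX` with edges `GX` among themselves and to the end points of the slots
(the "ports") — is attached, giving `M'` on `V ∪ VX`. If every way of covering the gadget's
vertices by port-to-port strands pairs up the two ports of slots only (`Exclusive`), then the
constrained Hamiltonian-path counts of `HamiltonianPathCount.lean` satisfy

  `#Ham(M', R, F) = Σ_{U ⊆ S} N(U) · #Ham(M, R ∪ U, F ∪ (S \ U))`,

`N(U)` being the number of covers of `VX` by strands joining the ports of the slots of `U`
(`coverCount`). This file sets up the notions (`Substitution`, `IsStrand`, `IsCover`,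
`coverCount`, `Exclusive`) and proves the CONTRACTION half: a Hamiltonian path of `M'` contracts
(`contract VX`, `HamiltonianPathSegments.lean`) to a Hamiltonian path of `M` using exactly the
slots `usedSlots` whose ports its gadget traversals join, and these traversals form a cover
(`Substitution.contract_mem`, `Substitution.segFamily_isCover`). The expansion half and the
counting identity are in `HamiltonianGadgetSubstitutionCount.lean`.

## References

* M. R. Garey, D. S. Johnson, *Computers and Intractability*, Freeman 1979, §3.2.2 (local
  replacement), §3.1.4 (the Hamiltonian circuit reductions).
* M. R. Garey, D. S. Johnson, R. E. Tarjan, SIAM J. Comput. 5 (1976) 704–714.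
* M. Liśkiewicz, M. Ogihara, S. Toda, TCS 304 (2003) 129–156, §3.
-/

namespace Literature.Combinatorics.SimpleGraph

open scoped Classical

variable {α : Type*} [DecidableEq α]

/-! ### Slots, ports, strands, covers -/

/-- `{a, b}` is one of the slots of `S` (in either orientation). [cite: GareyJohnson1979, §3.2.2] -/
def slotOf (S : Finset (α × α)) (a b : α) : Prop :=
  (a, b) ∈ S ∨ (b, a) ∈ S

/-- The **ports**: the end points of the slots. [cite: GareyJohnson1979, §3.2.2] -/
def ports (S : Finset (α × α)) : Finset α :=
  S.biUnion fun e => {e.1, e.2}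

/-- **A strand of the gadget** from `a` to `b`: a nonempty simple path `xs` inside `VX`, joined
to `a` and to `b` by gadget edges. [cite: GareyJohnson1979, §3.2.2] -/
def IsStrand (GX : _root_.SimpleGraph α) (VX : Finset α) (a b : α) (xs : List α) : Prop :=
  xs ≠ [] ∧ (∀ x ∈ xs, x ∈ VX) ∧ xs.Nodup ∧ List.IsChain GX.Adj (a :: (xs ++ [b]))

/-- **A cover of the gadget realising the slots `U`**: a strand from `e.1` to `e.2` for each slot
`e ∈ U` (and the empty list elsewhere), the strands pairwise disjoint and together covering `VX`.
[cite: GareyJohnson1979, §3.2.2] -/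
def IsCover (GX : _root_.SimpleGraph α) (VX : Finset α) (U : Finset (α × α))
    (f : α × α → List α) : Prop :=
  (∀ e ∈ U, IsStrand GX VX e.1 e.2 (f e)) ∧ (∀ e, e ∉ U → f e = []) ∧
    (∀ e ∈ U, ∀ e' ∈ U, e ≠ e' → List.Disjoint (f e) (f e')) ∧ ∀ x ∈ VX, ∃ e ∈ U, x ∈ f e

/-- The covers realising `U`. [cite: GareyJohnson1979, §3.2.2] -/
def coverSet (GX : _root_.SimpleGraph α) (VX : Finset α) (U : Finset (α × α)) : Set (α × α → List α) :=
  {f | IsCover GX VX U f}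

/-- **`N(U)`, the census of the gadget**: the number of covers realising `U` (e.g. `2¹²` for
each axis of the XOR-gadget of Garey–Johnson–Tarjan, `0` for every other pattern).
[cite: LiskiewiczOgiharaToda2003, §3 ("for each of the two vertical axes there are (4·2)⁴ = 2¹² Hamiltonian paths that traverse the gadget")] -/
noncomputable def coverCount (GX : _root_.SimpleGraph α) (VX : Finset α) (U : Finset (α × α)) : ℕ :=
  (coverSet GX VX U).ncard

/-- **Exclusivity of a gadget**: however its vertices are covered by pairwise disjoint
port-to-port strands with pairwise distinct end ports, every strand joins the two ports of a slot
("To go through all the nodes in an XOR-gadget one has to enter and exit on the same vertical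
axis"). The local hypothesis of the substitution theorem. [cite: LiskiewiczOgiharaToda2003, §3 (XOR-gadget)] -/
def Exclusive (GX : _root_.SimpleGraph α) (VX : Finset α) (S : Finset (α × α)) : Prop :=
  ∀ T : Set (α × List α × α),
    (∀ τ ∈ T, τ.1 ∈ ports S ∧ τ.2.2 ∈ ports S ∧ IsStrand GX VX τ.1 τ.2.2 τ.2.1) →
    (∀ τ ∈ T, ∀ τ' ∈ T, τ ≠ τ' →
      τ.1 ≠ τ'.1 ∧ τ.1 ≠ τ'.2.2 ∧ τ.2.2 ≠ τ'.1 ∧ τ.2.2 ≠ τ'.2.2 ∧ List.Disjoint τ.2.1 τ'.2.1) →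
    (∀ τ ∈ T, τ.1 ≠ τ.2.2) →
    (∀ x ∈ VX, ∃ τ ∈ T, x ∈ τ.2.1) →
    ∀ τ ∈ T, slotOf S τ.1 τ.2.2

/-- **A gadget substitution**: the base graph `M` on `V`, the slots `S` (edges of `M` inside `V`
with pairwise disjoint end points), the gadget `GX` on the fresh vertices `VX` with one port edge
at each port and no edge between two old vertices, the substituted graph `M'` (edges of `M`
inside `V` other than the slots, plus the gadget), and exclusivity.
[cite: GareyJohnson1979, §3.2.2 (local replacement)] -/
structure Substitution (M : _root_.SimpleGraph α) (V : Finset α) (S : Finset (α × α))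
    (GX : _root_.SimpleGraph α) (VX : Finset α) (M' : _root_.SimpleGraph α) : Prop where
  /-- the gadget vertices are fresh -/
  disjoint : Disjoint V VX
  /-- slots are edges of the base graph inside `V` -/
  slot_adj : ∀ e ∈ S, e.1 ∈ V ∧ e.2 ∈ V ∧ M.Adj e.1 e.2
  /-- distinct slots have no common end point (in particular a slot is listed in one orientation) -/
  slot_disjoint : ∀ e ∈ S, ∀ e' ∈ S, e ≠ e' → e.1 ≠ e'.1 ∧ e.1 ≠ e'.2 ∧ e.2 ≠ e'.1 ∧ e.2 ≠ e'.2
  /-- gadget edges join gadget vertices to gadget vertices or to ports -/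
  gadget_adj : ∀ a b, GX.Adj a b → (a ∈ VX ∨ b ∈ VX) ∧ (a ∈ VX ∨ a ∈ ports S) ∧ (b ∈ VX ∨ b ∈ ports S)
  /-- one port edge at each port -/
  port_unique : ∀ p ∈ ports S, ∀ x y, GX.Adj p x → GX.Adj p y → x = y
  /-- the substituted graph -/
  adj' : ∀ a b, M'.Adj a b ↔ (M.Adj a b ∧ a ∈ V ∧ b ∈ V ∧ ¬ slotOf S a b) ∨ GX.Adj a b
  /-- the gadget is exclusive -/
  exclusive : Exclusive GX VX S

/-! ### Elementary facts -/

omit [DecidableEq α] in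
/-- `slotOf` is symmetric. [folklore] -/
theorem slotOf_comm {S : Finset (α × α)} {a b : α} : slotOf S a b ↔ slotOf S b a := by
  unfold slotOf; exact Or.comm

/-- End points of slots are ports. [folklore] -/
theorem mem_ports_of_mem {S : Finset (α × α)} {e : α × α} (he : e ∈ S) : e.1 ∈ ports S ∧ e.2 ∈ ports S := by
  constructor <;> exact Finset.mem_biUnion.2 ⟨e, he, by simp⟩

/-- A port is an end point of a slot. [folklore] -/
theorem mem_ports_iff {S : Finset (α × α)} {p : α} : p ∈ ports S ↔ ∃ e ∈ S, p = e.1 ∨ p = e.2 := by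
  simp [ports]

omit [DecidableEq α] in
/-- A strand read backwards is a strand. [folklore] -/
theorem IsStrand.reverse {GX : _root_.SimpleGraph α} {VX : Finset α} {a b : α} {xs : List α}
    (h : IsStrand GX VX a b xs) : IsStrand GX VX b a xs.reverse := by
  obtain ⟨hne, hV, hnd, hc⟩ := h
  refine ⟨by simpa using hne, fun x hx => hV x (List.mem_reverse.1 hx), List.nodup_reverse.2 hnd, ?_⟩
  have : b :: (xs.reverse ++ [a]) = (a :: (xs ++ [b])).reverse := by simp
  rw [this, List.isChain_reverse]
  exact hc.imp fun x y h => h.symm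

omit [DecidableEq α] in
/-- The last link of a chain `a, zs, b`. [folklore] -/
theorem rel_getLast_of_isChain {R : α → α → Prop} {a b : α} {zs : List α}
    (hc : List.IsChain R (a :: (zs ++ [b]))) (hne : zs ≠ []) : R (zs.getLast hne) b := by
  rw [← List.cons_append, List.isChain_append] at hc
  refine hc.2.2 _ ?_ b rfl
  rw [List.getLast?_eq_some_getLast (List.cons_ne_nil a zs), List.getLast_cons hne]
  rfl

namespace Substitution

variable {M M' GX : _root_.SimpleGraph α} {V VX : Finset α} {S : Finset (α × α)}
  (h : Substitution M V S GX VX M')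
include h

/-- Old vertices are not gadget vertices. [folklore] -/
theorem not_mem_VX_of_mem_V {x : α} (hx : x ∈ V) : x ∉ VX :=
  Finset.disjoint_left.1 h.disjoint hx

/-- Ports are old vertices. [folklore] -/
theorem mem_V_of_mem_ports {p : α} (hp : p ∈ ports S) : p ∈ V := by
  obtain ⟨e, he, rfl | rfl⟩ := mem_ports_iff.1 hp
  · exact (h.slot_adj e he).1
  · exact (h.slot_adj e he).2.1

/-- A slot is listed in one orientation only. [folklore] -/
theorem not_mem_swap {e : α × α} (he : e ∈ S) : (e.2, e.1) ∉ S := by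
  intro he'
  by_cases heq : e = (e.2, e.1)
  · have h1 : e.1 = e.2 := by
      have := congrArg Prod.fst heq
      simpa using this
    exact (h.slot_adj e he).2.2.ne h1
  · exact (h.slot_disjoint e he _ he' heq).2.1 rfl

/-- An edge of `M'` between two old vertices is a non-slot edge of `M`. [folklore] -/
theorem adj_of_adj' {a b : α} (hab : M'.Adj a b) (ha : a ∉ VX) (hb : b ∉ VX) :
    M.Adj a b ∧ ¬ slotOf S a b := by
  rcases (h.adj' a b).1 hab with h1 | h1
  · exact ⟨h1.1, h1.2.2.2⟩
  · rcases (h.gadget_adj a b h1).1 with h2 | h2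
    · exact absurd h2 ha
    · exact absurd h2 hb

/-- An edge of `M'` with an end point in the gadget is a gadget edge. [folklore] -/
theorem gadj_of_adj' {a b : α} (hab : M'.Adj a b) (hor : a ∈ VX ∨ b ∈ VX) : GX.Adj a b := by
  rcases (h.adj' a b).1 hab with h1 | h1
  · rcases hor with h2 | h2
    · exact absurd h2 (h.not_mem_VX_of_mem_V h1.2.1)
    · exact absurd h2 (h.not_mem_VX_of_mem_V h1.2.2.1)
  · exact h1

/-! ### Segments of a Hamiltonian path of `M'` are strands between ports -/

variable {s t : α} {l' : List α}

/-- **A gadget traversal of a Hamiltonian path of `M'` is a strand.** [cite: GareyJohnson1979, §3.2.2] -/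
theorem isStrand_of_isSeg (hl : IsHamPathOn M' (V ∪ VX) s t l') {a b : α} {xs : List α}
    (hs : IsSeg VX l' a xs b) : IsStrand GX VX a b xs := by
  have hs' := hs
  obtain ⟨_, hne, hxs, ha, hb⟩ := hs'
  refine ⟨hne, hxs, ?_, ?_⟩
  · have := hs.nodup_piece hl.1
    exact (List.nodup_cons.1 this).2.of_append_left
  · have hc : List.IsChain M'.Adj (a :: (xs ++ [b])) := hl.2.2.2.2.infix hs.isInfix
    rw [List.isChain_iff_forall_rel_of_append_cons_cons] at hc ⊢
    intro u v l₁ l₂ huv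
    refine h.gadj_of_adj' (hc huv) ?_
    -- one of `u, v` is an inner vertex
    rcases l₁ with _ | ⟨w, l₁⟩
    · simp only [List.nil_append, List.cons.injEq] at huv
      obtain ⟨rfl, huv⟩ := huv
      obtain ⟨y, ys, rfl⟩ := List.exists_cons_of_ne_nil hne
      simp only [List.cons_append, List.cons.injEq] at huv
      exact Or.inr (huv.1 ▸ hxs y (by simp))
    · simp only [List.cons_append, List.cons.injEq] at huv
      obtain ⟨rfl, huv⟩ := huv
      have hu : u ∈ xs ++ [b] := by rw [huv]; simp
      rcases List.mem_append.1 hu with hu | hu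
      · exact Or.inl (hxs u hu)
      · simp only [List.mem_singleton] at hu
        subst hu
        -- `u = b` is the last entry; nothing comes after it
        exfalso
        have hnd : (xs ++ [u]).Nodup := (List.nodup_cons.1 (hs.nodup_piece hl.1)).2
        have := split_unique_of_nodup hnd rfl huv
        exact List.cons_ne_nil v l₂ this.2.symm

/-- The ports of a gadget traversal are ports of the gadget. [folklore] -/
theorem ports_of_isSeg (hl : IsHamPathOn M' (V ∪ VX) s t l') {a b : α} {xs : List α}
    (hs : IsSeg VX l' a xs b) : a ∈ ports S ∧ b ∈ ports S := by
  obtain ⟨hne, hxs, -, hc⟩ := h.isStrand_of_isSeg hl hs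
  constructor
  · obtain ⟨y, ys, rfl⟩ := List.exists_cons_of_ne_nil hne
    have hay : GX.Adj a y := (List.isChain_cons_cons.1 hc).1
    exact ((h.gadget_adj a y hay).2.1).resolve_left hs.2.2.2.1
  · have hlast : GX.Adj (xs.getLast hne) b := rel_getLast_of_isChain hc hne
    exact ((h.gadget_adj _ b hlast).2.2).resolve_left hs.2.2.2.2

/-- Two different gadget traversals of a Hamiltonian path of `M'` have pairwise distinct ports
and disjoint interiors. [folklore] -/
theorem isSeg_distinct (hl : IsHamPathOn M' (V ∪ VX) s t l') {a b a' b' : α} {xs xs' : List α}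
    (hs : IsSeg VX l' a xs b) (hs' : IsSeg VX l' a' xs' b') (hne : (a, xs, b) ≠ (a', xs', b')) :
    a ≠ a' ∧ a ≠ b' ∧ b ≠ a' ∧ b ≠ b' ∧ List.Disjoint xs xs' := by
  have hnd := hl.1
  -- two traversals sharing an inner vertex coincide
  have key : ∀ z, z ∈ xs → z ∈ xs' → False := fun z hz hz' => by
    obtain ⟨rfl, rfl, rfl⟩ := hs.eq_of_mem_mem hnd hs' hz hz'
    exact hne rfl
  -- a port is entered/left through its unique port edge
  have port_arg : ∀ {a b a' b' : α} {xs xs' : List α}, IsSeg VX l' a xs b → IsSeg VX l' a' xs' b' →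
      a = b' → ∃ z, z ∈ xs ∧ z ∈ xs' := by
    intro a b a' b' xs xs' hs hs' hab
    subst hab
    obtain ⟨hne1, -, -, hc1⟩ := h.isStrand_of_isSeg hl hs
    obtain ⟨hne2, -, -, hc2⟩ := h.isStrand_of_isSeg hl hs'
    obtain ⟨y, ys, rfl⟩ := List.exists_cons_of_ne_nil hne1
    have h1 : GX.Adj a y := (List.isChain_cons_cons.1 hc1).1
    have h2 : GX.Adj (xs'.getLast hne2) a := rel_getLast_of_isChain hc2 hne2
    have hp : a ∈ ports S := (h.ports_of_isSeg hl hs).1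
    have := h.port_unique a hp _ _ h1 h2.symm
    exact ⟨y, List.mem_cons_self, this ▸ List.getLast_mem hne2⟩
  refine ⟨fun heq => ?_, fun heq => ?_, fun heq => ?_, fun heq => ?_, fun z hz hz' => key z hz hz'⟩
  · subst heq
    obtain ⟨rfl, rfl⟩ := hs.right_unique hnd hs'
    exact hne rfl
  · obtain ⟨z, hz, hz'⟩ := port_arg hs hs' heq
    exact key z hz hz'
  · obtain ⟨z, hz', hz⟩ := port_arg hs' hs heq.symm
    exact key z hz hz'
  · subst heq
    obtain ⟨rfl, rfl⟩ := hs.left_unique hnd hs'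
    exact hne rfl

/-- **Every gadget traversal of a Hamiltonian path of `M'` joins the two ports of a slot**
(exclusivity applied to the family of all its traversals). [cite: GareyJohnson1979, §3.2.2] -/
theorem slotOf_of_isSeg (hsV : s ∈ V) (htV : t ∈ V) (hl : IsHamPathOn M' (V ∪ VX) s t l')
    {a b : α} {xs : List α} (hs : IsSeg VX l' a xs b) : slotOf S a b := by
  have hT := h.exclusive {τ | IsSeg VX l' τ.1 τ.2.1 τ.2.2} (fun τ hτ => ?_) (fun τ hτ τ' hτ' hne => ?_)
    (fun τ hτ => ?_) (fun x hx => ?_)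
  · exact hT (a, xs, b) hs
  · exact ⟨(h.ports_of_isSeg hl hτ).1, (h.ports_of_isSeg hl hτ).2, h.isStrand_of_isSeg hl hτ⟩
  · obtain ⟨a, xs, b⟩ := τ
    obtain ⟨a', xs', b'⟩ := τ'
    exact h.isSeg_distinct hl hτ hτ' hne
  · intro heq
    have := hτ.nodup_piece hl.1
    rw [heq] at this
    simp at this
  · have hxl : x ∈ l' := hl.mem_iff.2 (Finset.mem_union_right _ hx)
    obtain ⟨a, xs, b, hseg, hmem⟩ := exists_isSeg_of_mem hxl hx
      (fun c hc => by rw [hl.2.2.1] at hc; cases hc; exact h.not_mem_VX_of_mem_V hsV)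
      (fun c hc => by rw [hl.2.2.2.1] at hc; cases hc; exact h.not_mem_VX_of_mem_V htV)
    exact ⟨(a, xs, b), hseg, hmem⟩

/-! ### The contraction of a Hamiltonian path of `M'` -/

/-- **The slots used** by (the contraction of) a path. [cite: GareyJohnson1979, §3.2.2] -/
noncomputable def usedSlots (S : Finset (α × α)) (VX : Finset α) (l' : List α) : Finset (α × α) :=
  S.filter fun e => Uses (contract VX l') e

omit h in
/-- The used slots are slots. [folklore] -/
theorem usedSlots_subset (l' : List α) : usedSlots S VX l' ⊆ S :=
  Finset.filter_subset _ _

/-- A slot is never traversed directly by a path of `M'` (it is not an edge of `M'`). [folklore] -/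
theorem not_infix_of_slotOf (hl : IsHamPathOn M' (V ∪ VX) s t l') {a b : α} (hab : slotOf S a b) :
    ¬ [a, b] <:+: l' := by
  intro hinf
  have hadj : M'.Adj a b := hl.adj_of_uses (e := (a, b)) (Or.inl hinf)
  have ha : a ∈ V := by
    rcases hab with he | he
    · exact (h.slot_adj _ he).1
    · exact (h.slot_adj _ he).2.1
  have hb : b ∈ V := by
    rcases hab with he | he
    · exact (h.slot_adj _ he).2.1
    · exact (h.slot_adj _ he).1
  exact (h.adj_of_adj' hadj (h.not_mem_VX_of_mem_V ha) (h.not_mem_VX_of_mem_V hb)).2 hab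

/-- **A slot is used by the contraction iff one of its two orientations is a gadget traversal.**
[cite: GareyJohnson1979, §3.2.2] -/
theorem mem_usedSlots_iff (hl : IsHamPathOn M' (V ∪ VX) s t l') {e : α × α} :
    e ∈ usedSlots S VX l' ↔ e ∈ S ∧ ((∃ xs, IsSeg VX l' e.1 xs e.2) ∨ ∃ xs, IsSeg VX l' e.2 xs e.1) := by
  rw [usedSlots, Finset.mem_filter]
  refine and_congr_right fun he => ?_
  constructor
  · rintro (hinf | hinf)
    · rcases infix_contract_iff.1 hinf with ⟨h1, -, -⟩ | ⟨xs, hxs⟩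
      · exact absurd h1 (h.not_infix_of_slotOf hl (Or.inl he))
      · exact Or.inl ⟨xs, hxs⟩
    · rcases infix_contract_iff.1 hinf with ⟨h1, -, -⟩ | ⟨xs, hxs⟩
      · exact absurd h1 (h.not_infix_of_slotOf hl (Or.inr he))
      · exact Or.inr ⟨xs, hxs⟩
  · rintro (⟨xs, hxs⟩ | ⟨xs, hxs⟩)
    · exact Or.inl hxs.infix_contract
    · exact Or.inr hxs.infix_contract

/-- **The contraction of a Hamiltonian path of `M'` is a Hamiltonian path of `M`** with the
constraints transported: required edges stay required, the used slots are required, the other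
slots are not used, forbidden non-slot edges stay unused. [cite: GareyJohnson1979, §3.2.2] -/
theorem contract_mem (hsV : s ∈ V) (htV : t ∈ V) {R F : Finset (α × α)}
    (hR : ∀ e ∈ R, e.1 ∈ V ∧ e.2 ∈ V) (hF : ∀ e ∈ F, ¬ slotOf S e.1 e.2)
    (hl : l' ∈ hamSetRF M' (V ∪ VX) s t R F) :
    contract VX l' ∈ hamSetRF M V s t (R ∪ usedSlots S VX l') (F ∪ (S \ usedSlots S VX l')) := by
  obtain ⟨hham, hReq, hForb⟩ := hl
  have hsX := h.not_mem_VX_of_mem_V hsV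
  have htX := h.not_mem_VX_of_mem_V htV
  refine ⟨⟨nodup_contract hham.1, ?_, head?_contract hham.2.2.1 hsX, getLast?_contract hham.2.2.2.1 htX, ?_⟩,
    fun e he => ?_, fun e he => ?_⟩
  · rw [toFinset_contract, hham.2.1]
    ext x
    simp only [Finset.mem_filter, Finset.mem_union]
    constructor
    · rintro ⟨hx | hx, hxV⟩
      · exact hx
      · exact absurd hx hxV
    · exact fun hx => ⟨Or.inl hx, h.not_mem_VX_of_mem_V hx⟩
  · rw [List.isChain_iff_forall_rel_of_append_cons_cons]
    intro a b m₁ m₂ hm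
    have hinf : [a, b] <:+: contract VX l' := ⟨m₁, m₂, by rw [hm]; simp⟩
    rcases infix_contract_iff.1 hinf with ⟨h1, ha, hb⟩ | ⟨xs, hxs⟩
    · exact (h.adj_of_adj' (hham.adj_of_uses (e := (a, b)) (Or.inl h1)) ha hb).1
    · rcases h.slotOf_of_isSeg hsV htV hham hxs with he | he
      · exact (h.slot_adj _ he).2.2
      · exact (h.slot_adj _ he).2.2.symm
  · rcases Finset.mem_union.1 he with he | he
    · obtain ⟨h1, h2⟩ := hR e he
      rcases hReq e he with hinf | hinf
      · exact Or.inl (infix_contract_of_infix hinf (h.not_mem_VX_of_mem_V h1) (h.not_mem_VX_of_mem_V h2))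
      · exact Or.inr (infix_contract_of_infix hinf (h.not_mem_VX_of_mem_V h2) (h.not_mem_VX_of_mem_V h1))
    · exact (Finset.mem_filter.1 he).2
  · rcases Finset.mem_union.1 he with he | he
    · intro hu
      have key : ∀ p q, [p, q] <:+: contract VX l' → ¬ slotOf S p q → [p, q] <:+: l' := fun p q hpq hsl => by
        rcases infix_contract_iff.1 hpq with ⟨h1, -, -⟩ | ⟨xs, hxs⟩
        · exact h1
        · exact absurd (h.slotOf_of_isSeg hsV htV hham hxs) hsl
      rcases hu with hu | hu
      · exact hForb e he (Or.inl (key _ _ hu (hF e he)))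
      · exact hForb e he (Or.inr (key _ _ hu (fun hsl => hF e he (slotOf_comm.1 hsl))))
    · obtain ⟨heS, heU⟩ := Finset.mem_sdiff.1 he
      exact fun hu => heU (Finset.mem_filter.2 ⟨heS, hu⟩)

/-! ### The family of gadget traversals of a Hamiltonian path of `M'` is a cover -/

/-- **The traversal family** of a path: for a slot `e`, the inner vertices of the traversal from
`e.1` to `e.2` (or, read backwards, of the traversal from `e.2` to `e.1`); empty when the slot is
not traversed or `e` is not a slot. [cite: GareyJohnson1979, §3.2.2] -/
noncomputable def segFamily (S : Finset (α × α)) (VX : Finset α) (l' : List α) (e : α × α) : List α :=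
  if e ∈ S then
    if h₁ : ∃ xs, IsSeg VX l' e.1 xs e.2 then h₁.choose
    else if h₂ : ∃ xs, IsSeg VX l' e.2 xs e.1 then h₂.choose.reverse else []
  else []

omit h in
/-- The traversal family on a slot traversed forwards. [folklore] -/
theorem segFamily_of_isSeg (hl : IsHamPathOn M' (V ∪ VX) s t l') {e : α × α} (he : e ∈ S) {xs : List α}
    (hs : IsSeg VX l' e.1 xs e.2) : segFamily S VX l' e = xs := by
  have h₁ : ∃ xs, IsSeg VX l' e.1 xs e.2 := ⟨xs, hs⟩
  rw [segFamily, if_pos he, dif_pos h₁]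
  exact (h₁.choose_spec.right_unique hl.1 hs).1

/-- A slot is not traversed in both directions. [folklore] -/
theorem not_isSeg_swap (hl : IsHamPathOn M' (V ∪ VX) s t l') {a b : α} {xs xs' : List α}
    (hs : IsSeg VX l' a xs b) (hs' : IsSeg VX l' b xs' a) : False := by
  by_cases heq : (a, xs, b) = (b, xs', a)
  · simp only [Prod.mk.injEq] at heq
    obtain ⟨rfl, -⟩ := heq
    have := hs.nodup_piece hl.1
    simp at this
  · exact (h.isSeg_distinct hl hs hs' heq).2.1 rfl

/-- The traversal family on a slot traversed backwards. [folklore] -/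
theorem segFamily_of_isSeg_swap (hl : IsHamPathOn M' (V ∪ VX) s t l') {e : α × α} (he : e ∈ S)
    {xs : List α} (hs : IsSeg VX l' e.2 xs e.1) : segFamily S VX l' e = xs.reverse := by
  have h₁ : ¬ ∃ xs, IsSeg VX l' e.1 xs e.2 := fun ⟨xs', hs'⟩ => h.not_isSeg_swap hl hs' hs
  have h₂ : ∃ xs, IsSeg VX l' e.2 xs e.1 := ⟨xs, hs⟩
  rw [segFamily, if_pos he, dif_neg h₁, dif_pos h₂, (h₂.choose_spec.right_unique hl.1 hs).1]

/-- The traversal family vanishes off the used slots. [folklore] -/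
theorem segFamily_of_not_mem (hl : IsHamPathOn M' (V ∪ VX) s t l') {e : α × α}
    (he : e ∉ usedSlots S VX l') : segFamily S VX l' e = [] := by
  rw [segFamily]
  by_cases heS : e ∈ S
  · rw [h.mem_usedSlots_iff hl] at he
    have h₁ : ¬ ∃ xs, IsSeg VX l' e.1 xs e.2 := fun hx => he ⟨heS, Or.inl hx⟩
    have h₂ : ¬ ∃ xs, IsSeg VX l' e.2 xs e.1 := fun hx => he ⟨heS, Or.inr hx⟩
    rw [if_pos heS, dif_neg h₁, dif_neg h₂]
  · rw [if_neg heS]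

/-- **The traversal family of a Hamiltonian path of `M'` is a cover realising its used slots.**
[cite: GareyJohnson1979, §3.2.2] -/
theorem segFamily_isCover (hsV : s ∈ V) (htV : t ∈ V) (hl : IsHamPathOn M' (V ∪ VX) s t l') :
    IsCover GX VX (usedSlots S VX l') (segFamily S VX l') := by
  refine ⟨fun e he => ?_, fun e he => h.segFamily_of_not_mem hl he, fun e he e' he' hne => ?_, fun x hx => ?_⟩
  · obtain ⟨heS, ⟨xs, hs⟩ | ⟨xs, hs⟩⟩ := (h.mem_usedSlots_iff hl).1 he
    · rw [segFamily_of_isSeg hl heS hs]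
      exact h.isStrand_of_isSeg hl hs
    · rw [h.segFamily_of_isSeg_swap hl heS hs]
      exact (h.isStrand_of_isSeg hl hs).reverse
  · -- two different used slots: their traversals are different segments
    obtain ⟨heS, hor⟩ := (h.mem_usedSlots_iff hl).1 he
    obtain ⟨heS', hor'⟩ := (h.mem_usedSlots_iff hl).1 he'
    have hdis := h.slot_disjoint e heS e' heS' hne
    -- name the two segments with their orientation
    have main : ∀ {a b a' b' : α} {xs xs' : List α}, IsSeg VX l' a xs b → IsSeg VX l' a' xs' b' →
        a ≠ a' → List.Disjoint xs xs' := fun hs hs' hne' =>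
      (h.isSeg_distinct hl hs hs' (fun heq => hne' (by simp only [Prod.mk.injEq] at heq; exact heq.1))).2.2.2.2
    rcases hor with ⟨xs, hs⟩ | ⟨xs, hs⟩ <;> rcases hor' with ⟨xs', hs'⟩ | ⟨xs', hs'⟩
    · rw [segFamily_of_isSeg hl heS hs, segFamily_of_isSeg hl heS' hs']
      exact main hs hs' hdis.1
    · rw [segFamily_of_isSeg hl heS hs, h.segFamily_of_isSeg_swap hl heS' hs']
      exact fun z hz hz' => main hs hs' hdis.2.1 hz (List.mem_reverse.1 hz')
    · rw [h.segFamily_of_isSeg_swap hl heS hs, segFamily_of_isSeg hl heS' hs']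
      exact fun z hz hz' => main hs hs' hdis.2.2.1 (List.mem_reverse.1 hz) hz'
    · rw [h.segFamily_of_isSeg_swap hl heS hs, h.segFamily_of_isSeg_swap hl heS' hs']
      exact fun z hz hz' => main hs hs' hdis.2.2.2 (List.mem_reverse.1 hz) (List.mem_reverse.1 hz')
  · have hxl : x ∈ l' := hl.mem_iff.2 (Finset.mem_union_right _ hx)
    obtain ⟨a, xs, b, hseg, hmem⟩ := exists_isSeg_of_mem hxl hx
      (fun c hc => by rw [hl.2.2.1] at hc; cases hc; exact h.not_mem_VX_of_mem_V hsV)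
      (fun c hc => by rw [hl.2.2.2.1] at hc; cases hc; exact h.not_mem_VX_of_mem_V htV)
    rcases h.slotOf_of_isSeg hsV htV hl hseg with he | he
    · refine ⟨(a, b), (h.mem_usedSlots_iff hl).2 ⟨he, Or.inl ⟨xs, hseg⟩⟩, ?_⟩
      rw [segFamily_of_isSeg hl he hseg]
      exact hmem
    · refine ⟨(b, a), (h.mem_usedSlots_iff hl).2 ⟨he, Or.inr ⟨xs, hseg⟩⟩, ?_⟩
      rw [h.segFamily_of_isSeg_swap hl he hseg]
      exact List.mem_reverse.2 hmem

/-! ### Re-expansion by the traversal family -/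

omit h in
/-- **Orientation of a family** for insertion: between `a` and `b` insert the strand of the slot
`(a, b)`, or the reversed strand of the slot `(b, a)`. [cite: GareyJohnson1979, §3.2.2] -/
def orient (f : α × α → List α) (a b : α) : List α :=
  if f (a, b) ≠ [] then f (a, b) else (f (b, a)).reverse

/-- **Re-expanding the contraction by the traversal family gives the path back.**
[cite: GareyJohnson1979, §3.2.2] -/
theorem expand_segFamily_contract (hsV : s ∈ V) (htV : t ∈ V) (hl : IsHamPathOn M' (V ∪ VX) s t l') :
    expand (orient (segFamily S VX l')) (contract VX l') = l' := by
  refine expand_contract (fun c hc => ?_) (fun c hc => ?_) (fun a xs b hs => ?_) (fun a b hab ha hb => ?_)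
  · rw [hl.2.2.1] at hc; cases hc; exact h.not_mem_VX_of_mem_V hsV
  · rw [hl.2.2.2.1] at hc; cases hc; exact h.not_mem_VX_of_mem_V htV
  · -- a segment `a, xs, b` joins the ports of a slot, and `orient` picks `xs`
    rcases h.slotOf_of_isSeg hsV htV hl hs with he | he
    · have h1 : segFamily S VX l' (a, b) = xs := segFamily_of_isSeg hl he hs
      rw [orient, if_pos (by rw [h1]; exact hs.2.1), h1]
    · have h1 : segFamily S VX l' (b, a) = xs.reverse := h.segFamily_of_isSeg_swap hl he hs
      have h2 : segFamily S VX l' (a, b) = [] := by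
        rw [segFamily, if_neg (h.not_mem_swap he)]
      rw [orient, h2, if_neg (by simp), h1, List.reverse_reverse]
  · -- consecutive old vertices: no strand is inserted
    have hab' : ¬ slotOf S a b := fun hsl => h.not_infix_of_slotOf hl hsl hab
    have h1 : segFamily S VX l' (a, b) = [] := by
      rw [segFamily, if_neg (fun he => hab' (Or.inl he))]
    have h2 : segFamily S VX l' (b, a) = [] := by
      rw [segFamily, if_neg (fun he => hab' (Or.inr he))]
    rw [orient, h1, if_neg (by simp), h2, List.reverse_nil]

end Substitution

end Literature.Combinatorics.SimpleGraph
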